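import Summits.MatrixMultiplication.OmegaCensus.STPP222Pow6From124OfPow555
import Summits.MatrixMultiplication.OmegaCensus.STPP222Pow6From126

/-!
# ω-census, STPP pattern `(2,2,2)⁶`: `N₆ ≤ 125 ⟺ N₆ ≤ 124 ⟺ (ℤ/5)³ admits the pattern`, and `N₆ = 126 ⟺` it does not (kernel equivalences)

HONEST FRAMING (pub-omega census; verbatim): lottery ticket; floor = certified bounds/negative ranges.
Census STRUCTURE bookkeeping (question Q7 of the pub-omega cell: the uniform threshold `N_k` = least order from which EVERY
finite abelian group admits `k` simultaneous-TPP triples of 2-subsets, CKSU 2005 Def. 5.1, tree form `IsSTPP`), not progress on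
`ω`: a `(2,2,2)⁶` family has volume `48` and certifies no matrix-multiplication bound of interest.

The tree has `N₆ ≤ 126` (`exists_isSTPP_222pow6_of_card_ge126`, `STPP222Pow6From126.lean`) and the CONDITIONAL law from `124`
(`exists_isSTPP_222pow6_of_card_ge124_of_pow555`, `STPP222Pow6From124OfPow555.lean`: IF `ℤ/5 × ℤ/5 × ℤ/5` admits `(2,2,2)⁶` THEN every
finite abelian group of order `≥ 124` does).  Whether `(ℤ/5)³` admits `(2,2,2)⁶` is OPEN at the time of writing (no family found by any
finder of the cell, no impossibility proof).  This file records the UNCONDITIONAL equivalences that make the cell's "`N₆` exactness"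
question ONE finite problem about ONE group, taking no side:
* `forall_card_ge125_iff_pow555`, `forall_card_ge124_iff_pow555` — the law from `125` ⟺ the law from `124` ⟺ `(ℤ/5)³` admits `(2,2,2)⁶`
  (`(ℤ/5)³` has order `125`, so it is an instance of either law; conversely the conditional law); hence `N₆ ≠ 125`
  (`forall_card_ge124_of_forall_card_ge125`);
* `n6_eq_126_iff_not_pow555` — `N₆ = 126` EXACTLY (law from `126` AND no law from `125`) ⟺ `(ℤ/5)³` admits no `(2,2,2)⁶` family;
* `not_pow555_iff_exists_card_eq125_not` — `(ℤ/5)³` admits none ⟺ some finite abelian group of order exactly `125` admits none.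
Statements quantify over `G : Type` (universe `0`, as the census's exactness rows `stpp222Cube_n3_eq_32` etc.); the laws they invoke are
universe-polymorphic.

References: H. Cohn, R. Kleinberg, B. Szegedy, C. Umans, FOCS 2005 (arXiv:math/0511460), Def. 5.1.  Record: pub-omega HOME `STATUS.md`
2026-08-27 (stpp-3 gen 20; the `N₆` exactness cell P-041).
-/

open Literature.Computability.AlgebraicComplexity Finset

namespace Summit.MatrixMultiplication.OmegaCensus

namespace N6Iff555

open N6From124

/-- `ℤ/5 × ℤ/5 × ℤ/5` has order `125`. -/
theorem card_zmod5_cube : Nat.card (ZMod 5 × ZMod 5 × ZMod 5) = 125 := by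
  simp

/-- The converse direction: a law from `125` covers `(ℤ/5)³` itself (order `125`). [folklore] -/
theorem pow555_of_forall_card_ge125
    (h : ∀ (G : Type) [AddCommGroup G] [Finite G], 125 ≤ Nat.card G →
      ∃ A B C : Fin 6 → Finset G, IsSTPP A B C ∧ ∀ i, (A i).card = 2 ∧ (B i).card = 2 ∧ (C i).card = 2) :
    ∃ A B C : Fin 6 → Finset (ZMod 5 × ZMod 5 × ZMod 5), IsSTPP A B C ∧ ∀ i, (A i).card = 2 ∧ (B i).card = 2 ∧ (C i).card = 2 :=
  h (ZMod 5 × ZMod 5 × ZMod 5) card_zmod5_cube.ge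

/-- **Exactness reduction, KERNEL, UNCONDITIONAL: the law "every finite abelian group of order `≥ 125` admits `(2,2,2)⁶`" holds IF AND ONLY IF
`ℤ/5 × ℤ/5 × ℤ/5` admits `(2,2,2)⁶`.**  (`⇐`: the conditional law from `124`; `⇒`: instantiate at `(ℤ/5)³`.)  The census question "is `N₆ = 126` or
`≤ 124`?" is therefore ONE finite problem about ONE group; this file takes no side. [cite: CohnKleinbergSzegedyUmans2005, Def. 5.1] -/
theorem forall_card_ge125_iff_pow555 :
    (∀ (G : Type) [AddCommGroup G] [Finite G], 125 ≤ Nat.card G →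
      ∃ A B C : Fin 6 → Finset G, IsSTPP A B C ∧ ∀ i, (A i).card = 2 ∧ (B i).card = 2 ∧ (C i).card = 2) ↔
    ∃ A B C : Fin 6 → Finset (ZMod 5 × ZMod 5 × ZMod 5), IsSTPP A B C ∧ ∀ i, (A i).card = 2 ∧ (B i).card = 2 ∧ (C i).card = 2 :=
  ⟨pow555_of_forall_card_ge125, fun h555 G _ _ hG => exists_isSTPP_222pow6_of_card_ge124_of_pow555 h555 (by omega)⟩

/-- **The same with `124`: the law from `124` ⟺ `(ℤ/5)³` admits `(2,2,2)⁶`** (both groups of order `124` are kernel hosts, `STPP222Pow6SeedsG`).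
In particular `N₆ ≠ 125`. [cite: CohnKleinbergSzegedyUmans2005, Def. 5.1] -/
theorem forall_card_ge124_iff_pow555 :
    (∀ (G : Type) [AddCommGroup G] [Finite G], 124 ≤ Nat.card G →
      ∃ A B C : Fin 6 → Finset G, IsSTPP A B C ∧ ∀ i, (A i).card = 2 ∧ (B i).card = 2 ∧ (C i).card = 2) ↔
    ∃ A B C : Fin 6 → Finset (ZMod 5 × ZMod 5 × ZMod 5), IsSTPP A B C ∧ ∀ i, (A i).card = 2 ∧ (B i).card = 2 ∧ (C i).card = 2 :=
  ⟨fun h => pow555_of_forall_card_ge125 fun G _ _ hG => h G (by omega),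
    fun h555 G _ _ hG => exists_isSTPP_222pow6_of_card_ge124_of_pow555 h555 hG⟩

/-- **`N₆ ≠ 125` (KERNEL, unconditional)**: a law from `125` is already a law from `124`. [cite: CohnKleinbergSzegedyUmans2005, Def. 5.1] -/
theorem forall_card_ge124_of_forall_card_ge125
    (h : ∀ (G : Type) [AddCommGroup G] [Finite G], 125 ≤ Nat.card G →
      ∃ A B C : Fin 6 → Finset G, IsSTPP A B C ∧ ∀ i, (A i).card = 2 ∧ (B i).card = 2 ∧ (C i).card = 2) :
    ∀ (G : Type) [AddCommGroup G] [Finite G], 124 ≤ Nat.card G →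
      ∃ A B C : Fin 6 → Finset G, IsSTPP A B C ∧ ∀ i, (A i).card = 2 ∧ (B i).card = 2 ∧ (C i).card = 2 :=
  forall_card_ge124_iff_pow555.2 (forall_card_ge125_iff_pow555.1 h)

/-- **`N₆ = 126` EXACTLY ⟺ `(ℤ/5)³` admits no `(2,2,2)⁶` family (KERNEL, unconditional).**  Left side, spelled out: the law from `126` holds
(it does: the tree's `exists_isSTPP_222pow6_of_card_ge126`, `STPP222Pow6From126.lean`) AND the law from `125` fails.  Neither side is decided
here. [cite: CohnKleinbergSzegedyUmans2005, Def. 5.1] -/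
theorem n6_eq_126_iff_not_pow555 :
    ((∀ (G : Type) [AddCommGroup G] [Finite G], 126 ≤ Nat.card G →
        ∃ A B C : Fin 6 → Finset G, IsSTPP A B C ∧ ∀ i, (A i).card = 2 ∧ (B i).card = 2 ∧ (C i).card = 2) ∧
      ¬ ∀ (G : Type) [AddCommGroup G] [Finite G], 125 ≤ Nat.card G →
        ∃ A B C : Fin 6 → Finset G, IsSTPP A B C ∧ ∀ i, (A i).card = 2 ∧ (B i).card = 2 ∧ (C i).card = 2) ↔
    ¬ ∃ A B C : Fin 6 → Finset (ZMod 5 × ZMod 5 × ZMod 5), IsSTPP A B C ∧ ∀ i, (A i).card = 2 ∧ (B i).card = 2 ∧ (C i).card = 2 :=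
  ⟨fun h h555 => h.2 (forall_card_ge125_iff_pow555.2 h555),
    fun h => ⟨fun _ _ _ hG => N6From126.exists_isSTPP_222pow6_of_card_ge126 hG, fun hall => h (forall_card_ge125_iff_pow555.1 hall)⟩⟩

/-- **The failing groups of order `125`, if any, are copies of `(ℤ/5)³`** in the following operational sense: `(ℤ/5)³` admits no `(2,2,2)⁶`
family ⟺ SOME finite abelian group of order exactly `125` admits none (`⇒`: itself; `⇐`: the conditional law from `124` covers every group of
order `125`). [cite: CohnKleinbergSzegedyUmans2005, Def. 5.1] -/
theorem not_pow555_iff_exists_card_eq125_not :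
    (¬ ∃ A B C : Fin 6 → Finset (ZMod 5 × ZMod 5 × ZMod 5), IsSTPP A B C ∧ ∀ i, (A i).card = 2 ∧ (B i).card = 2 ∧ (C i).card = 2) ↔
    ∃ (G : Type) (_ : AddCommGroup G) (_ : Finite G), Nat.card G = 125 ∧
      ¬ ∃ A B C : Fin 6 → Finset G, IsSTPP A B C ∧ ∀ i, (A i).card = 2 ∧ (B i).card = 2 ∧ (C i).card = 2 :=
  ⟨fun h => ⟨ZMod 5 × ZMod 5 × ZMod 5, inferInstance, inferInstance, card_zmod5_cube, h⟩,
    fun ⟨G, _, _, hG, hno⟩ h555 => hno (exists_isSTPP_222pow6_of_card_ge124_of_pow555 h555 (by omega))⟩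

end N6Iff555

end Summit.MatrixMultiplication.OmegaCensus
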